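/-
Copyright (c) 2026 The HCML crux team. All rights reserved.
Released under Apache 2.0 license as described in the file LICENSE.
Authors: K2E3-p14 (g5) (explicit-unit `hodgecm-mathlib-K2E3-p14-g5`)
-/
import Summits.HodgeConjecture.HodgeConjecture.Theorems.K2E3GLnUnipotentAdHeight        -- ★ (V0) p858112 (this seat): unipotent entries ∕ torus part read off `𝔅`
import Summits.HodgeConjecture.HodgeConjecture.Theorems.K2E3GL3HeightBallExhaustion      -- ★ (B4-0 file 2) p858011 (this seat): `isCompact_setOf_scaled_integral`
import Literature.NumberTheory.Automorphic.GL3SplitTorusOrbitalIntegral                 -- ★ `det_one_sub_boxAd_glDiagonal_fin_three`; brings ★ `lintegral_upperUnitriangular_three_conj_diagonal_eq_mul`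
import HarnessLib

/-!
# (GL-[M6]-sc, VOL brick V2) The Heisenberg shear count: `μ_N {n : n t n⁻¹ ∈ 𝔅_m} ≤ |(t₀−t₁)(t₀−t₂)(t₁−t₂)|⁻¹ · μ_N(N-box of radius m)`

Cell `hodgecm-mathlib`, Track B, line `K2_E3_EllipticInputs`; payer «GL-[M6]-sc» of leaf (11-3-split-sc-NE) (dealer K2E3-plan (g3) D63, line lead K2E3-p23
(g5), RULINGS #11 (M11-1) ∕ #12 (M12-4), BLUEPRINT v4 §2 «VOL-split»).  In Harish-Chandra's volume count for the split torus [HarishChandra1970, Part VII §3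
pp. 71–73] the unipotent variable of `z = k · n · a` is controlled through the SHEAR `n ↦ n t n⁻¹ = t · (t⁻¹ n t n⁻¹)`: by Rogawski's substitution on the upper
unitriangular group `N₃` of `GL₃(F)` (★ `lintegral_upperUnitriangular_three_conj_diagonal_eq_mul`: `∫⁻_N φ(n t n⁻¹) dn = ∏_{i<j} ‖1 − t_i∕t_j‖⁻¹ ∫⁻_N φ(n t) dn`)
and the reading `𝔅_m(n t) ⇒ |ϖ^m n_{ij}| ≤ 1` of ★ V0, for `t = diag(t₀,t₁,t₂)` regular with INTEGRAL entries:
  `μ_N {n : 𝔅_m(n t n⁻¹)} ≤ |(t₀−t₁)(t₀−t₂)(t₁−t₂)|_F⁻¹ · μ_N {n : |ϖ^m n_{ij}| ≤ 1 ∀ i j}`,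
the Jacobian `∏ ‖1 − t_i∕t_j‖⁻¹ = |t₁||t₂|² ∕ |(t₀−t₁)(t₀−t₂)(t₁−t₂)|` being at most `|D(t)|^{−1∕2} = |(t₀−t₁)(t₀−t₂)(t₁−t₂)|⁻¹` — the `|D♮|^{−1∕2}`-factor of
Theorem 16's majorant (`|D| = |D♮|·|t₀t₁t₂|²`).
* §1 entries of `n ∈ N₃` and of `n⁻¹` (`apply_self_eq_one_of_mem`, `apply_eq_zero_of_mem`, the explicit inverse relations), and the bound
  `v_pow_mul_inv_apply_le_one_of_mem`: `|ϖ^m n_{ij}| ≤ 1 ∀ ⇒ |ϖ^{2m} (n⁻¹)_{kl}| ≤ 1 ∀`;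
* §2 the `N`-BOX `{n ∈ N₃ : |ϖ^m n_{ij}| ≤ 1}` is COMPACT (inside the compact GL-ball ★ `isCompact_setOf_scaled_integral … m (m+m)`), hence of finite Haar measure
  (`isCompact_nBox`, `measure_nBox_lt_top`) — the local constant `c(m)` of the volume count;
* §3 **`measure_setOf_adBall_conj_diagonal_le`** — the displayed count.

HONEST LABEL: HC_CM is proved only modulo the 7 printed citations (2 remaining named inputs: hLiu418 = stmt-HodgeConjecture-24832, h413 =
stmt-HodgeConjecture-24833) until rung 0 closes; count-neutral (kernel lane `--supports stmt-HodgeConjecture-24833 --as helper`), THEOREMS ONLY — no `def`, no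
instance, no notation, no `sorry`.

## References
* [HarishChandra1970] Harish-Chandra (notes by G. van Dijk), *Harmonic Analysis on Reductive p-adic Groups*, LNM 162 (1970), Part VII §3 pp. 71–73.
* [Rogawski1990] J. D. Rogawski, *Automorphic Representations of Unitary Groups in Three Variables* (1990), §4.13, Lemma 4.13.1 and proof, pp. 69–70.
-/

set_option linter.dupNamespace false

noncomputable section

open MeasureTheory Measure Set Function Topology
open scoped MatrixGroups NNReal ENNReal WithZero
open Matrix ValuativeRel
open Literature.NumberTheory.Automorphic Literature.NumberTheory.GaloisRepresentations Literature.NumberTheory.GaloisRepresentations.IsNonarchimedeanLocalField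
open Summit.HodgeConjecture.HodgeConjecture.Cruxes.H413.K2E3GLnAdHeightBalls Summit.HodgeConjecture.HodgeConjecture.Cruxes.H413.K2E3GLnUnipotentAdHeight
open Summit.HodgeConjecture.HodgeConjecture.Cruxes.H413.K2E3GL3HeightBallExhaustion

namespace Summit.HodgeConjecture.HodgeConjecture.Cruxes.H413.K2E3GL3SplitShearCount

/-! ## §1 Entries of `n ∈ N₃` and of `n⁻¹` -/

section Entries

variable {F : Type*} [Field F]

/-- A unitriangular element has unit diagonal. [folklore] -/
theorem apply_self_eq_one_of_mem {n : GL (Fin 3) F} (hn : n ∈ unipotentRadicalGL F (id : Fin 3 → Fin 3)) (j : Fin 3) :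
    (n : Matrix (Fin 3) (Fin 3) F) j j = 1 := by
  have h := ((mem_unipotentRadicalGL_iff_entry (R := F) (c := (id : Fin 3 → Fin 3)) n).1 hn).2 j j rfl
  rw [h, Matrix.one_apply_eq]

/-- A unitriangular element vanishes below the diagonal. [folklore] -/
theorem apply_eq_zero_of_mem {n : GL (Fin 3) F} (hn : n ∈ unipotentRadicalGL F (id : Fin 3 → Fin 3)) {i j : Fin 3} (hji : j < i) :
    (n : Matrix (Fin 3) (Fin 3) F) i j = 0 := by
  have h : (n : Matrix (Fin 3) (Fin 3) F).BlockTriangular (id : Fin 3 → Fin 3) :=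
    ((mem_unipotentRadicalGL_iff_entry (R := F) (c := (id : Fin 3 → Fin 3)) n).1 hn).1
  exact h hji

/-- **The inverse of `n = [[1,a,c],[0,1,b],[0,0,1]]` has upper entries `−a`, `−b`, `ab − c`** (read off `n · n⁻¹ = 1`). [folklore] -/
theorem inv_apply_eq_of_mem {n : GL (Fin 3) F} (hn : n ∈ unipotentRadicalGL F (id : Fin 3 → Fin 3)) :
    ((n⁻¹ : GL (Fin 3) F) : Matrix (Fin 3) (Fin 3) F) 0 1 = -(n : Matrix (Fin 3) (Fin 3) F) 0 1 ∧
      ((n⁻¹ : GL (Fin 3) F) : Matrix (Fin 3) (Fin 3) F) 1 2 = -(n : Matrix (Fin 3) (Fin 3) F) 1 2 ∧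
      ((n⁻¹ : GL (Fin 3) F) : Matrix (Fin 3) (Fin 3) F) 0 2 =
        (n : Matrix (Fin 3) (Fin 3) F) 0 1 * (n : Matrix (Fin 3) (Fin 3) F) 1 2 - (n : Matrix (Fin 3) (Fin 3) F) 0 2 := by
  have hn' : n⁻¹ ∈ unipotentRadicalGL F (id : Fin 3 → Fin 3) := Subgroup.inv_mem _ hn
  set X : Matrix (Fin 3) (Fin 3) F := (n : Matrix (Fin 3) (Fin 3) F) with hX
  set P : Matrix (Fin 3) (Fin 3) F := ((n⁻¹ : GL (Fin 3) F) : Matrix (Fin 3) (Fin 3) F) with hP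
  have hmul : X * P = 1 := by rw [hX, hP, ← Units.val_mul, mul_inv_cancel, Units.val_one]
  have hX00 : X 0 0 = 1 := apply_self_eq_one_of_mem hn 0
  have hX11 : X 1 1 = 1 := apply_self_eq_one_of_mem hn 1
  have hX10 : X 1 0 = 0 := apply_eq_zero_of_mem hn (by decide)
  have hP11 : P 1 1 = 1 := apply_self_eq_one_of_mem hn' 1
  have hP22 : P 2 2 = 1 := apply_self_eq_one_of_mem hn' 2
  have hP21 : P 2 1 = 0 := apply_eq_zero_of_mem hn' (by decide)
  have e01 := congrFun (congrFun hmul 0) 1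
  have e12 := congrFun (congrFun hmul 1) 2
  have e02 := congrFun (congrFun hmul 0) 2
  rw [Matrix.mul_apply, Fin.sum_univ_three, Matrix.one_apply_ne (by decide)] at e01 e12 e02
  rw [hX00, hP11, hP21] at e01
  rw [hX10, hX11, hP22] at e12
  rw [hX00, hP22] at e02
  have h01 : P 0 1 = -X 0 1 := by linear_combination e01
  have h12 : P 1 2 = -X 1 2 := by linear_combination e12
  refine ⟨h01, h12, ?_⟩
  rw [h12] at e02
  linear_combination e02

variable [Valued F ℤᵐ⁰]

/-- **`|ϖ^m n_{ij}| ≤ 1 ∀ ⇒ |ϖ^{2m} (n⁻¹)_{kl}| ≤ 1 ∀`** for `n ∈ N₃` (`|ϖ| ≤ 1`): the entries of `n⁻¹` are `1`, `0`, `−a`, `−b`, `ab − c`. [folklore] -/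
theorem v_pow_mul_inv_apply_le_one_of_mem {ϖ : F} (hϖ1 : Valued.v ϖ ≤ 1) {m : ℕ} {n : GL (Fin 3) F} (hn : n ∈ unipotentRadicalGL F (id : Fin 3 → Fin 3))
    (hb : ∀ i j, Valued.v (ϖ ^ m * (n : Matrix (Fin 3) (Fin 3) F) i j) ≤ 1) (k l : Fin 3) :
    Valued.v (ϖ ^ (m + m) * ((n⁻¹ : GL (Fin 3) F) : Matrix (Fin 3) (Fin 3) F) k l) ≤ 1 := by
  have hn' : n⁻¹ ∈ unipotentRadicalGL F (id : Fin 3 → Fin 3) := Subgroup.inv_mem _ hn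
  obtain ⟨h01, h12, h02⟩ := inv_apply_eq_of_mem hn
  have hϖm : Valued.v (ϖ ^ m) ≤ 1 := by rw [map_pow]; exact pow_le_one' hϖ1 _
  have hϖmm : Valued.v (ϖ ^ (m + m)) ≤ 1 := by rw [map_pow]; exact pow_le_one' hϖ1 _
  have h3 : ∀ i : Fin 3, i = 0 ∨ i = 1 ∨ i = 2 := by decide
  -- the generic shapes
  have hdiag : ∀ j, Valued.v (ϖ ^ (m + m) * ((n⁻¹ : GL (Fin 3) F) : Matrix (Fin 3) (Fin 3) F) j j) ≤ 1 := fun j => by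
    rw [apply_self_eq_one_of_mem hn' j, mul_one]; exact hϖmm
  have hlow : ∀ i j : Fin 3, j < i → Valued.v (ϖ ^ (m + m) * ((n⁻¹ : GL (Fin 3) F) : Matrix (Fin 3) (Fin 3) F) i j) ≤ 1 := fun i j hji => by
    rw [apply_eq_zero_of_mem hn' hji, mul_zero, map_zero]; exact zero_le
  have hneg : ∀ i j : Fin 3, Valued.v (ϖ ^ (m + m) * -(n : Matrix (Fin 3) (Fin 3) F) i j) ≤ 1 := fun i j => by
    rw [mul_neg, Valuation.map_neg, pow_add, mul_assoc, map_mul]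
    exact mul_le_one' hϖm (hb i j)
  rcases h3 k with rfl | rfl | rfl <;> rcases h3 l with rfl | rfl | rfl
  · exact hdiag 0
  · rw [h01]; exact hneg 0 1
  · rw [h02, mul_sub]
    refine (Valuation.map_sub _ _ _).trans (max_le ?_ ?_)
    · have heq : ϖ ^ (m + m) * ((n : Matrix (Fin 3) (Fin 3) F) 0 1 * (n : Matrix (Fin 3) (Fin 3) F) 1 2) =
          (ϖ ^ m * (n : Matrix (Fin 3) (Fin 3) F) 0 1) * (ϖ ^ m * (n : Matrix (Fin 3) (Fin 3) F) 1 2) := by ring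
      rw [heq, map_mul]
      exact mul_le_one' (hb 0 1) (hb 1 2)
    · rw [pow_add, mul_assoc, map_mul]
      exact mul_le_one' hϖm (hb 0 2)
  · exact hlow 1 0 (by decide)
  · exact hdiag 1
  · rw [h12]; exact hneg 1 2
  · exact hlow 2 0 (by decide)
  · exact hlow 2 1 (by decide)
  · exact hdiag 2

end Entries

/-! ## §2 The `N`-box is compact, of finite Haar measure -/

section Box

variable {F : Type*} [Field F] [Valued F ℤᵐ⁰] [ValuativeRel F] [(Valued.v : Valuation F ℤᵐ⁰).Compatible] [IsNonarchimedeanLocalField F]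

/-- **THE `N`-BOX OF RADIUS `m` IS COMPACT**: `{n ∈ N₃ : |ϖ^m n_{ij}| ≤ 1 ∀ i j}` is a closed subset of the compact GL-ball `{ϖ^m g, ϖ^{2m} g⁻¹ integral}` ★.
[cite: HarishChandra1970, Part VII §2 p. 69] -/
theorem isCompact_nBox {ϖ : F} (hϖ : Valued.v ϖ = WithZero.exp (-1 : ℤ)) (m : ℕ) :
    IsCompact {n : ↥(unipotentRadicalGL F (id : Fin 3 → Fin 3)) | ∀ i j, Valued.v (ϖ ^ m * ((n : GL (Fin 3) F) : Matrix (Fin 3) (Fin 3) F) i j) ≤ 1} := by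
  haveI : IsTopologicalRing F := inferInstance
  haveI : T2Space F := (isLocalField F).toT2Space
  have hϖ0 : ϖ ≠ 0 := ne_zero_of_v_eq_exp hϖ
  have hϖ1 : Valued.v ϖ ≤ 1 := v_le_one_of_v_eq_exp hϖ
  rw [Subtype.isCompact_iff]
  have hsub : ((↑) : ↥(unipotentRadicalGL F (id : Fin 3 → Fin 3)) → GL (Fin 3) F) ''
      {n : ↥(unipotentRadicalGL F (id : Fin 3 → Fin 3)) | ∀ i j, Valued.v (ϖ ^ m * ((n : GL (Fin 3) F) : Matrix (Fin 3) (Fin 3) F) i j) ≤ 1} =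
      (unipotentRadicalGL F (id : Fin 3 → Fin 3) : Set (GL (Fin 3) F)) ∩ {g : GL (Fin 3) F | ∀ i j, Valued.v (ϖ ^ m * (g : Matrix (Fin 3) (Fin 3) F) i j) ≤ 1} := by
    ext g
    constructor
    · rintro ⟨n, hn, rfl⟩; exact ⟨n.2, hn⟩
    · rintro ⟨hg, hb⟩; exact ⟨⟨g, hg⟩, hb, rfl⟩
  rw [hsub]
  refine (isCompact_setOf_scaled_integral (n := Fin 3) hϖ0 m (m + m)).of_isClosed_subset ?_ ?_
  · refine (isClosed_unipotentRadicalGL (R := F) (id : Fin 3 → Fin 3)).inter ?_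
    have hC : IsClosed {x : F | Valued.v x ≤ 1} := Valued.isClosed_integer F
    simp only [Set.setOf_forall]
    exact isClosed_iInter fun i => isClosed_iInter fun j => hC.preimage (continuous_const.mul (Units.continuous_val.matrix_elem i j))
  · rintro g ⟨hg, hb⟩
    exact ⟨hb, v_pow_mul_inv_apply_le_one_of_mem hϖ1 hg hb⟩

/-- The `N`-box has FINITE measure for every measure finite on compacta (e.g. a Haar measure of `N₃`) — the local constant `c(m)` of the volume count.
[cite: HarishChandra1970, Part VII §3 p. 72] -/
theorem measure_nBox_lt_top {ϖ : F} (hϖ : Valued.v ϖ = WithZero.exp (-1 : ℤ)) (m : ℕ)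
    [MeasurableSpace (GL (Fin 3) F)] [BorelSpace (GL (Fin 3) F)]
    (μN : Measure ↥(unipotentRadicalGL F (id : Fin 3 → Fin 3))) [IsFiniteMeasureOnCompacts μN] :
    μN {n | ∀ i j, Valued.v (ϖ ^ m * ((n : GL (Fin 3) F) : Matrix (Fin 3) (Fin 3) F) i j) ≤ 1} < ⊤ :=
  (isCompact_nBox hϖ m).measure_lt_top

end Box

/-! ## §3 The shear count -/

section Count

variable {F : Type*} [Field F] [Valued F ℤᵐ⁰] [ValuativeRel F] [(Valued.v : Valuation F ℤᵐ⁰).Compatible] [IsNonarchimedeanLocalField F]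
  [MeasurableSpace (GL (Fin 3) F)] [BorelSpace (GL (Fin 3) F)]

/-- **THE HEISENBERG SHEAR COUNT.**  For `t = diag(t₀,t₁,t₂)` with pairwise distinct INTEGRAL entries and every Haar measure `μ_N` of the upper unitriangular group
`N₃ ≤ GL₃(F)`:  `μ_N {n : 𝔅_m(n t n⁻¹)} ≤ |(t₀−t₁)(t₀−t₂)(t₁−t₂)|_F⁻¹ · μ_N {n : |ϖ^m n_{ij}| ≤ 1 ∀ i j}` — Rogawski's substitution `n ↦ n t n⁻¹` (★) with Jacobian
`∏_{i<j}‖1 − t_i∕t_j‖⁻¹ = |t₁ t₂²| ∕ |(t₀−t₁)(t₀−t₂)(t₁−t₂)| ≤ |(t₀−t₁)(t₀−t₂)(t₁−t₂)|⁻¹`, then ★ V0 `𝔅_m(n t) ⇒ n ∈ N-box(m)`.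
[cite: HarishChandra1970, Part VII §3 p. 72] [cite: Rogawski1990, §4.13, proof of Lemma 4.13.1, p. 70] -/
theorem measure_setOf_adBall_conj_diagonal_le (μN : Measure ↥(unipotentRadicalGL F (id : Fin 3 → Fin 3))) [IsHaarMeasure μN]
    (t : Fin 3 → Fˣ) (h01 : (t 0 : F) ≠ t 1) (h02 : (t 0 : F) ≠ t 2) (h12 : (t 1 : F) ≠ t 2) (ht1 : ∀ i, Valued.v (t i : F) ≤ 1) (ϖ : F) (m : ℕ) :
    μN {n | ∀ i j k l, Valued.v (ϖ ^ m * ((((n : GL (Fin 3) F) * glDiagonal 3 F t * ((n : GL (Fin 3) F))⁻¹ : GL (Fin 3) F) : Matrix (Fin 3) (Fin 3) F) i j *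
        ((((n : GL (Fin 3) F) * glDiagonal 3 F t * ((n : GL (Fin 3) F))⁻¹)⁻¹ : GL (Fin 3) F) : Matrix (Fin 3) (Fin 3) F) k l)) ≤ 1} ≤
      ((normAbs F (((t 0 : F) - t 1) * ((t 0 : F) - t 2) * ((t 1 : F) - t 2)))⁻¹ : ℝ≥0) *
        μN {n | ∀ i j, Valued.v (ϖ ^ m * ((n : GL (Fin 3) F) : Matrix (Fin 3) (Fin 3) F) i j) ≤ 1} := by
  classical
  haveI : BorelSpace ↥(unipotentRadicalGL F (id : Fin 3 → Fin 3)) := Subtype.borelSpace _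
  -- the ball `S = 𝔅_m` upstairs and its indicator
  set S : Set (GL (Fin 3) F) := {g | ∀ i j k l, Valued.v (ϖ ^ m * ((g : Matrix (Fin 3) (Fin 3) F) i j * ((g⁻¹ : GL (Fin 3) F) : Matrix (Fin 3) (Fin 3) F) k l)) ≤ 1}
    with hS
  have hSm : MeasurableSet S := (isOpen_setOf_adBall ϖ m).measurableSet
  have hφ : Measurable (S.indicator fun _ => (1 : ℝ≥0∞)) := measurable_const.indicator hSm
  set γ : GL (Fin 3) F := glDiagonal 3 F t with hγ
  -- LHS as an integral of the indicator along the shear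
  have hconj : Continuous fun n : ↥(unipotentRadicalGL F (id : Fin 3 → Fin 3)) => (n : GL (Fin 3) F) * γ * ((n : GL (Fin 3) F))⁻¹ :=
    (continuous_subtype_val.mul continuous_const).mul continuous_subtype_val.inv
  have hmul : Continuous fun n : ↥(unipotentRadicalGL F (id : Fin 3 → Fin 3)) => (n : GL (Fin 3) F) * γ := continuous_subtype_val.mul continuous_const
  have eL : μN {n | ∀ i j k l, Valued.v (ϖ ^ m * ((((n : GL (Fin 3) F) * γ * ((n : GL (Fin 3) F))⁻¹ : GL (Fin 3) F) : Matrix (Fin 3) (Fin 3) F) i j *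
        ((((n : GL (Fin 3) F) * γ * ((n : GL (Fin 3) F))⁻¹)⁻¹ : GL (Fin 3) F) : Matrix (Fin 3) (Fin 3) F) k l)) ≤ 1} =
      ∫⁻ n, S.indicator (fun _ => (1 : ℝ≥0∞)) ((n : GL (Fin 3) F) * γ * ((n : GL (Fin 3) F))⁻¹) ∂μN := by
    have hset : {n : ↥(unipotentRadicalGL F (id : Fin 3 → Fin 3)) | ∀ i j k l, Valued.v (ϖ ^ m *
        ((((n : GL (Fin 3) F) * γ * ((n : GL (Fin 3) F))⁻¹ : GL (Fin 3) F) : Matrix (Fin 3) (Fin 3) F) i j *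
        ((((n : GL (Fin 3) F) * γ * ((n : GL (Fin 3) F))⁻¹)⁻¹ : GL (Fin 3) F) : Matrix (Fin 3) (Fin 3) F) k l)) ≤ 1} =
        (fun n : ↥(unipotentRadicalGL F (id : Fin 3 → Fin 3)) => (n : GL (Fin 3) F) * γ * ((n : GL (Fin 3) F))⁻¹) ⁻¹' S := rfl
    rw [hset, ← lintegral_indicator_one (hSm.preimage hconj.measurable)]
    simp only [Set.indicator_apply, Set.mem_preimage, Pi.one_apply]
  have eR : ∫⁻ n, S.indicator (fun _ => (1 : ℝ≥0∞)) ((n : GL (Fin 3) F) * γ) ∂μN =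
      μN {n | ∀ i j k l, Valued.v (ϖ ^ m * ((((n : GL (Fin 3) F) * γ : GL (Fin 3) F) : Matrix (Fin 3) (Fin 3) F) i j *
        ((((n : GL (Fin 3) F) * γ)⁻¹ : GL (Fin 3) F) : Matrix (Fin 3) (Fin 3) F) k l)) ≤ 1} := by
    have hset : {n : ↥(unipotentRadicalGL F (id : Fin 3 → Fin 3)) | ∀ i j k l, Valued.v (ϖ ^ m *
        ((((n : GL (Fin 3) F) * γ : GL (Fin 3) F) : Matrix (Fin 3) (Fin 3) F) i j *
        ((((n : GL (Fin 3) F) * γ)⁻¹ : GL (Fin 3) F) : Matrix (Fin 3) (Fin 3) F) k l)) ≤ 1} =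
        (fun n : ↥(unipotentRadicalGL F (id : Fin 3 → Fin 3)) => (n : GL (Fin 3) F) * γ) ⁻¹' S := rfl
    rw [hset, ← lintegral_indicator_one (hSm.preimage hmul.measurable)]
    simp only [Set.indicator_apply, Set.mem_preimage, Pi.one_apply]
  -- Rogawski's substitution
  have hP : glDiagonal 3 F t ∈ standardParabolicGL F ![false, false, true] := by
    rw [mem_standardParabolicGL_iff, coe_glDiagonal]; exact Matrix.blockTriangular_diagonal _
  have hdet := det_one_sub_boxAd_glDiagonal_fin_three (R := F) t hP
  have hK : (1 - Matrix.of fun q q' : {i : Fin 3 // ![false, false, true] i = false} × {j : Fin 3 // ![false, false, true] j = true} =>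
      (((⟨glDiagonal 3 F t, hP⟩ : standardParabolicGL F ![false, false, true]) : GL (Fin 3) F) : Matrix (Fin 3) (Fin 3) F) q.1 q'.1 *
        ((((⟨glDiagonal 3 F t, hP⟩ : standardParabolicGL F ![false, false, true])⁻¹ : standardParabolicGL F ![false, false, true]) : GL (Fin 3) F) :
          Matrix (Fin 3) (Fin 3) F) q'.2 q.2).det ≠ 0 := by
    rw [hdet]
    refine mul_ne_zero (sub_ne_zero.2 fun h => h02 ?_) (sub_ne_zero.2 fun h => h12 ?_)
    · have := congrArg (fun x : F => x * (t 2 : F)) h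
      simpa [mul_assoc] using this.symm
    · have := congrArg (fun x : F => x * (t 2 : F)) h
      simpa [mul_assoc] using this.symm
  letI : MeasurableSpace F := borel F
  haveI : BorelSpace F := ⟨rfl⟩
  have hshear := lintegral_upperUnitriangular_three_conj_diagonal_eq_mul F t h01 ⟨glDiagonal 3 F t, hP⟩ rfl hK μN _ hφ
  rw [eL, hshear, hdet]
  -- the Jacobian is at most `|Δ|⁻¹` and the remaining integral is the measure of `{n : 𝔅_m(n t)} ⊆ N-box(m)`
  refine mul_le_mul' ?_ ?_
  · -- constants, in `ℝ≥0`
    refine ENNReal.coe_le_coe.2 ?_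
    have ht0 : ∀ i, (t i : F) ≠ 0 := fun i => (t i).ne_zero
    set Δ : F := ((t 0 : F) - t 1) * ((t 0 : F) - t 2) * ((t 1 : F) - t 2) with hΔ
    have hΔ0 : Δ ≠ 0 := mul_ne_zero (mul_ne_zero (sub_ne_zero.2 h01) (sub_ne_zero.2 h02)) (sub_ne_zero.2 h12)
    set X : F := (1 - (t 0 : F) * (((t 2)⁻¹ : Fˣ) : F)) * (1 - (t 1 : F) * (((t 2)⁻¹ : Fˣ) : F)) with hX
    set Y : F := 1 - (t 0 : F) * (t 1 : F)⁻¹ with hY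
    -- `X · Y · (t₂ t₂ t₁) = −Δ`
    have hprod : X * Y * ((t 2 : F) * (t 2 : F) * (t 1 : F)) = -Δ := by
      rw [hX, hY, hΔ, Units.val_inv_eq_inv_val]
      field_simp
      ring
    have hnormXY : normAbs F (X * Y) * normAbs F ((t 2 : F) * (t 2 : F) * (t 1 : F)) = normAbs F Δ := by
      rw [← map_mul, hprod, normAbs_apply, normAbs_apply, Valuation.map_neg]
    have ht2t2t1 : normAbs F ((t 2 : F) * (t 2 : F) * (t 1 : F)) ≤ 1 := by
      rw [normAbs_le_one_iff, ← v_le_one_iff_mem_integer, map_mul, map_mul]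
      exact mul_le_one' (mul_le_one' (ht1 2) (ht1 2)) (ht1 1)
    have hle : normAbs F Δ ≤ normAbs F (X * Y) := by
      rw [← hnormXY]
      exact mul_le_of_le_one_right zero_le ht2t2t1
    have hΔpos : 0 < normAbs F Δ := pos_iff_ne_zero.2 ((map_ne_zero (normAbs F)).2 hΔ0)
    rw [← map_mul, ← mul_inv, map_inv₀]
    exact inv_anti₀ hΔpos hle
  · rw [eR]
    refine measure_mono fun n hn => fun i j => ?_
    have hu' : ∀ j, ((((n : GL (Fin 3) F))⁻¹ : GL (Fin 3) F) : Matrix (Fin 3) (Fin 3) F) j j = 1 := fun j => by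
      rw [← Subgroup.coe_inv]; exact apply_self_eq_one_of_mem (n⁻¹).2 j
    exact v_pow_mul_apply_le_one_of_adBall_mul_diagonal (coe_glDiagonal 3 F t) hu' hn i j

end Count

end Summit.HodgeConjecture.HodgeConjecture.Cruxes.H413.K2E3GL3SplitShearCount

end
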